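import Literature.Analysis.OperatorTheory.Enflo2023.Eq18
import HarnessLib

/-!
# Enflo 2023, v2 p.6 eq. (18) on the WHOLE domain of `ε ↦ ℓ_ε`: continuity at an attained least radius, by completeness alone

Source under adjudication: Per H. Enflo, *On the invariant subspace problem in Hilbert spaces*, arXiv:2305.15442 (v1
2023, v2 2024), bib key `Enflo2023` — a CLAIMED proof of the invariant subspace problem for operators on a separable
Hilbert space.  This file is part of the kernel-tight typing of the manuscript by the b2b-enflo repair cell
(formaliser 1, Part A: v2 eq. (1)–(27), the set-up, the constructions `V_y`, `ℓ'`, `[ ]x₀`, Lemma 1 and Case I/II of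
the main step).  It records what FOLLOWS (proved implications from the manuscript's displayed hypotheses) and, where a
step does not follow, the typed inference together with its refutation.  NOTHING here asserts that the manuscript's
main theorem holds; no declaration concludes the invariant subspace problem for an arbitrary operator.  Value
(BLOCK-2b): theorems / refutations of typed inferences about a text — not progress on the problem.

THE CLAIM (v2 p.6, eq. (18)): "with `ℓ_ε(T)` having minimal `‖·‖₂`-norm for `ℓ` with `‖x₀ − ℓ(T)y‖ ≤ ε, … (18)
`ε → ℓ_ε(T)` is a continuous function."  `Eq18.lean` proved it on every OPEN set of radii carrying minimal vectors
(`continuousOn_minimiser`, `Vy.eq18`, `Vy.eq18_Ioi`).  The natural domain of `ε ↦ ℓ_ε` is the set of radii at which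
problem (1) is feasible, `feasibleRadii V x₀ = {ε | ∃ a, ‖x₀ − V a‖ ≤ ε}` — an up-set of `ℝ`, hence an open ray
`(ε_*, ∞)` or a CLOSED ray `[ε_*, ∞)` (the least radius `ε_* = dist(x₀, V E)` may be attained, e.g. `ε_* = ‖x₀ − y‖`
when `x₀ − y ⟂ T^j y` for all `j`, or `ε_* = 0` when `x₀ ∈ V_y ℓ²`).  At an attained least radius the open-set theorem
is silent.  This file closes the remaining one-sided case, so that (18) holds on the ENTIRE domain of definition of
`ε ↦ ℓ_ε`, with no topological input beyond the completeness of the coefficient space (no weak compactness):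
* `feasibleRadii`, `Ioi_infDist_subset_feasibleRadii`, `feasibleRadii_subset_Ici_infDist`,
  `mem_feasibleRadii_iff_exists_isMinimal` — the domain: `(d, ∞) ⊆ feasibleRadii V x₀ ⊆ [d, ∞)`, `d = dist(x₀, V E)`,
  and (for complete `E`) it is exactly the set of radii carrying a minimal vector;
* `IsMinimal.norm_sub_sq_le` — the one-sided parallelogram bound: for radii `ε' ≤ ε`,
  `‖ℓ_ε − ℓ_{ε'}‖² ≤ 2(‖ℓ_{ε'}‖² − ‖ℓ_ε‖²)` (midpoint minimiser has norm `≥ ‖ℓ_ε‖` by monotonicity);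
* `continuousWithinAt_Ici_minimiser` — **right-continuity at the least radius**: if `ℓ_ε` is minimal at every
  `ε ≥ ε₀` then `ℓ_ε → ℓ_{ε₀}` as `ε ↓ ε₀`.  Proof: along `ε_n = ε₀ + 1/(n+1)` the norms `N(ε_n) = ‖ℓ_{ε_n}‖` increase
  to `S ≤ N(ε₀)`, so by the one-sided bound `(ℓ_{ε_n})` is CAUCHY, converges (completeness of `E`) to some `m`;
  `m` is feasible at radius `ε₀` (`‖x₀ − V m‖ = lim ‖x₀ − V ℓ_{ε_n}‖ ≤ lim ε_n = ε₀`) and `‖m‖ = S`, whence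
  `N(ε₀) ≤ ‖m‖ = S ≤ N(ε₀)`; then `‖ℓ_ε − ℓ_{ε₀}‖² ≤ 2(N(ε₀)² − N(ε)²) ≤ 2(N(ε₀)² − N(ε_n)²) → 0` for `ε₀ ≤ ε ≤ ε_n`;
* `continuousOn_Ici_minimiser` — (18) on a closed ray `[ε₀, ∞)`; `continuousOn_minimiser_feasibleRadii` — (18) on
  the whole feasibility domain (closed or open ray alike); `exists_continuousOn_minimiser_feasibleRadii` — with
  existence and uniqueness: THE map `ε ↦ ℓ_ε` is defined exactly on `feasibleRadii V x₀`
  (`mem_feasibleRadii_iff_exists_isMinimal`) and is continuous there; `continuousOn_norm_minimiser_feasibleRadii` —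
  so the convex non-increasing `N(ε) = ‖ℓ_ε‖` is continuous up to and including an attained least radius;
* `Vy.eq18_Ici`, `Vy.eq18_feasibleRadii` — on the paper's objects (`V = V_y` of eq. (2), `‖T‖ < 1`, any `x₀, y`):
  `ε ↦ ℓ_ε` (in `ℓ²`) and `ε ↦ ℓ_ε(T)` (in `B(H)`, operator norm) are continuous on the closed ray `[‖x₀ − y‖, ∞)`
  and on the whole domain of radii at which `ℓ_ε` exists — the maximal literal reading of (18).
VERDICT for the record: unchanged — (18) FOLLOWS (from the convexity of (1) and, at an attained least radius, from
completeness); the text never cites (18) afterwards; nothing downstream depends on this file.  It removes the last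
scope qualification ("open sets of radii") on a numbered display of Part A.
Origin: planner-b2b-enflo-1-g18-0 (formaliser 1, gen 18), 2026-08-19.  Imports `…Enflo2023.Eq18` only; Mathlib
(`tendsto_atTop_ciSup`, `Metric.cauchySeq_iff'`, `cauchySeq_tendsto_of_complete`, `le_of_tendsto_of_tendsto'`).
-/

noncomputable section

open scoped InnerProductSpace Topology
open Filter ContinuousLinearMap

namespace Literature.Analysis.OperatorTheory.Enflo2023

section coefficient

variable {E H : Type*} [NormedAddCommGroup E] [InnerProductSpace ℂ E]
  [NormedAddCommGroup H] [InnerProductSpace ℂ H]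

/-- The feasible sets of (1) increase with the radius. [cite: Enflo2023, v2 p.2, eq. (1)] -/
lemma feasible_mono (V : E →L[ℂ] H) (x₀ : H) {ε ε' : ℝ} (h : ε ≤ ε') :
    feasible V x₀ ε ⊆ feasible V x₀ ε' := fun _ ha => le_trans (show _ ≤ ε from ha) h

/-- The natural domain of `ε ↦ ℓ_ε`: the radii `ε` at which problem (1) is feasible (`‖x₀ − V a‖ ≤ ε` solvable). [cite: Enflo2023, v2 p.2, eq. (1)] -/
def feasibleRadii (V : E →L[ℂ] H) (x₀ : H) : Set ℝ := {ε | (feasible V x₀ ε).Nonempty}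

/-- Unfolding `feasibleRadii`. [cite: Enflo2023, v2 p.2, eq. (1)] -/
lemma mem_feasibleRadii (V : E →L[ℂ] H) (x₀ : H) {ε : ℝ} :
    ε ∈ feasibleRadii V x₀ ↔ (feasible V x₀ ε).Nonempty := Iff.rfl

/-- The feasibility domain is an up-set: with a radius it contains every larger radius. [cite: Enflo2023, v2 p.2, eq. (1)] -/
lemma Ici_subset_feasibleRadii (V : E →L[ℂ] H) (x₀ : H) {ε : ℝ} (hε : ε ∈ feasibleRadii V x₀) :
    Set.Ici ε ⊆ feasibleRadii V x₀ := fun _ hε' => hε.mono (feasible_mono V x₀ hε')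

/-- Feasible radii are non-negative. [cite: Enflo2023, v2 p.2, eq. (1)] -/
lemma feasibleRadii_subset_Ici (V : E →L[ℂ] H) (x₀ : H) : feasibleRadii V x₀ ⊆ Set.Ici 0 :=
  fun _ ⟨_, ha⟩ => le_trans (norm_nonneg _) ha

/-- Every radius strictly above `dist(x₀, V E)` is feasible. [cite: Enflo2023, v2 p.2, eq. (1)] -/
lemma Ioi_infDist_subset_feasibleRadii (V : E →L[ℂ] H) (x₀ : H) :
    Set.Ioi (Metric.infDist x₀ (Set.range V)) ⊆ feasibleRadii V x₀ := by
  intro ε hε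
  have hne : (Set.range V).Nonempty := ⟨V 0, 0, rfl⟩
  obtain ⟨_, ⟨a, rfl⟩, hlt⟩ := (Metric.infDist_lt_iff hne).1 (show Metric.infDist x₀ (Set.range V) < ε from hε)
  exact ⟨a, by rw [mem_feasible, ← dist_eq_norm]; exact hlt.le⟩

/-- No radius strictly below `dist(x₀, V E)` is feasible; so the feasibility domain is the ray from `dist(x₀, V E)`,
open or closed according as the distance is attained. [cite: Enflo2023, v2 p.2, eq. (1)] -/
lemma feasibleRadii_subset_Ici_infDist (V : E →L[ℂ] H) (x₀ : H) :
    feasibleRadii V x₀ ⊆ Set.Ici (Metric.infDist x₀ (Set.range V)) := by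
  rintro ε ⟨a, ha⟩
  have h1 : Metric.infDist x₀ (Set.range V) ≤ dist x₀ (V a) := Metric.infDist_le_dist_of_mem ⟨a, rfl⟩
  rw [dist_eq_norm] at h1
  exact le_trans h1 ha

/-- The feasibility domain is exactly the set of radii at which a minimal vector `ℓ_ε` exists (coefficient space
complete). [cite: Enflo2023, v2 p.2, eq. (1)] -/
theorem mem_feasibleRadii_iff_exists_isMinimal [CompleteSpace E] (V : E →L[ℂ] H) (x₀ : H) {ε : ℝ} :
    ε ∈ feasibleRadii V x₀ ↔ ∃ a, IsMinimal V x₀ ε a :=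
  ⟨fun h => exists_isMinimal V x₀ ε h, fun ⟨a, ha⟩ => ⟨a, ha.1⟩⟩

/-- The shape of the domain at a feasible radius `ε₀`: either the domain is exactly the closed ray `[ε₀, ∞)`
(`ε₀` is the attained least radius), or some feasible radius lies strictly below `ε₀` (so `ε₀` is an interior point
of the domain). [cite: Enflo2023, v2 p.2, eq. (1)] -/
lemma feasibleRadii_eq_Ici_or (V : E →L[ℂ] H) (x₀ : H) {ε₀ : ℝ} (hε₀ : ε₀ ∈ feasibleRadii V x₀) :
    feasibleRadii V x₀ = Set.Ici ε₀ ∨ ∃ ε₁ ∈ feasibleRadii V x₀, ε₁ < ε₀ := by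
  by_cases h : ∃ ε₁ ∈ feasibleRadii V x₀, ε₁ < ε₀
  · exact Or.inr h
  · push Not at h
    exact Or.inl (Set.Subset.antisymm (fun e he => h e he) (Ici_subset_feasibleRadii V x₀ hε₀))

namespace IsMinimal

variable {V : E →L[ℂ] H} {x₀ : H}

/-- The one-sided parallelogram bound: for minimal vectors `a, b, c` at radii `ε, ε', (ε + ε')/2` with `ε' ≤ ε`,
`‖a − b‖² ≤ 2(‖b‖² − ‖a‖²)` (`IsMinimal.parallelogram` and `‖c‖ ≥ ‖a‖`, the midpoint radius being `≤ ε`). [cite: Enflo2023, v2 p.6, eq. (18)] -/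
theorem norm_sub_sq_le {ε ε' : ℝ} {a b c : E} (ha : IsMinimal V x₀ ε a) (hb : IsMinimal V x₀ ε' b)
    (hc : IsMinimal V x₀ ((ε + ε') / 2) c) (hle : ε' ≤ ε) :
    ‖a - b‖ ^ 2 ≤ 2 * (‖b‖ ^ 2 - ‖a‖ ^ 2) := by
  have h1 := ha.parallelogram hb hc
  have h2 : ‖a‖ ≤ ‖c‖ := hc.norm_le_of_le ha (by linarith)
  nlinarith [norm_nonneg a, norm_nonneg c]

end IsMinimal

variable {V : E →L[ℂ] H} {x₀ : H} {ℓ : ℝ → E} {ε₀ : ℝ}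

/-- **Right-continuity of `ε ↦ ℓ_ε` at the least radius** (the case the open-set theorem `continuousOn_minimiser`
does not reach): if `ℓ_ε` is the minimal vector of (1) at every radius `ε ≥ ε₀` and the coefficient space is complete,
then `ℓ_ε → ℓ_{ε₀}` as `ε ↓ ε₀`.  Along `ε_n = ε₀ + 1/(n+1)` the norms increase to `S ≤ ‖ℓ_{ε₀}‖`; by
`IsMinimal.norm_sub_sq_le` the minimisers form a Cauchy sequence, whose limit is feasible at `ε₀` with norm `S`,
forcing `S = ‖ℓ_{ε₀}‖`; then `‖ℓ_ε − ℓ_{ε₀}‖² ≤ 2(‖ℓ_{ε₀}‖² − ‖ℓ_{ε_n}‖²)` for `ε₀ ≤ ε ≤ ε_n`. [cite: Enflo2023, v2 p.6, eq. (18)] -/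
theorem continuousWithinAt_Ici_minimiser [CompleteSpace E]
    (hℓ : ∀ ε ∈ Set.Ici ε₀, IsMinimal V x₀ ε (ℓ ε)) :
    ContinuousWithinAt ℓ (Set.Ici ε₀) ε₀ := by
  have h0 : IsMinimal V x₀ ε₀ (ℓ ε₀) := hℓ ε₀ Set.self_mem_Ici
  -- `N(ε) = ‖ℓ ε‖` is non-increasing on `[ε₀, ∞)`
  have hanti : ∀ {ε ε' : ℝ}, ε₀ ≤ ε → ε ≤ ε' → ‖ℓ ε'‖ ≤ ‖ℓ ε‖ := fun hε hle =>
    (hℓ _ hε).norm_le_of_le (hℓ _ (le_trans hε hle)) hle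
  -- the one-sided parallelogram bound against `ε₀`
  have hpar : ∀ {ε : ℝ}, ε₀ ≤ ε → ‖ℓ ε - ℓ ε₀‖ ^ 2 ≤ 2 * (‖ℓ ε₀‖ ^ 2 - ‖ℓ ε‖ ^ 2) := fun {ε} hε =>
    (hℓ ε hε).norm_sub_sq_le h0 (hℓ _ (show ε₀ ≤ (ε + ε₀) / 2 by linarith)) hε
  -- the radii `r n = ε₀ + 1/(n+1)`
  set r : ℕ → ℝ := fun n => ε₀ + 1 / ((n : ℝ) + 1) with hr
  have hr_ge : ∀ n, ε₀ ≤ r n := fun n => by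
    have : (0 : ℝ) < 1 / ((n : ℝ) + 1) := by positivity
    simp only [hr]; linarith
  have hr_anti : Antitone r := fun m n hmn => by
    have hm : (0 : ℝ) < (m : ℝ) + 1 := by positivity
    have hmn' : (m : ℝ) + 1 ≤ (n : ℝ) + 1 := by exact_mod_cast Nat.succ_le_succ hmn
    simp only [hr]
    gcongr
  have hr_tend : Tendsto r atTop (𝓝 ε₀) := by
    have h := (tendsto_one_div_add_atTop_nhds_zero_nat).const_add ε₀
    rw [add_zero] at h
    exact h
  -- `N(r n)` is non-decreasing and bounded by `N(ε₀)`: it converges to its supremum `S ≤ N(ε₀)`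
  have hmono : Monotone (fun n => ‖ℓ (r n)‖) := fun m n hmn => hanti (hr_ge n) (hr_anti hmn)
  have hbdd : ∀ n, ‖ℓ (r n)‖ ≤ ‖ℓ ε₀‖ := fun n => hanti le_rfl (hr_ge n)
  have hBdd : BddAbove (Set.range fun n => ‖ℓ (r n)‖) := ⟨‖ℓ ε₀‖, by rintro _ ⟨n, rfl⟩; exact hbdd n⟩
  set S : ℝ := ⨆ n, ‖ℓ (r n)‖ with hS
  have hNS : Tendsto (fun n => ‖ℓ (r n)‖) atTop (𝓝 S) := tendsto_atTop_ciSup hmono hBdd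
  have hS_le : S ≤ ‖ℓ ε₀‖ := ciSup_le hbdd
  have hle_S : ∀ n, ‖ℓ (r n)‖ ≤ S := fun n => le_ciSup hBdd n
  have hNS2 : Tendsto (fun n => ‖ℓ (r n)‖ ^ 2) atTop (𝓝 (S ^ 2)) := hNS.pow 2
  -- the minimisers along `r n` form a Cauchy sequence
  have hcauchy : CauchySeq (fun n => ℓ (r n)) := by
    refine Metric.cauchySeq_iff'.2 fun η hη => ?_
    have hev : ∀ᶠ n in atTop, S ^ 2 - η ^ 2 / 2 < ‖ℓ (r n)‖ ^ 2 :=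
      hNS2.eventually (lt_mem_nhds (by nlinarith))
    obtain ⟨K, hK⟩ := Filter.eventually_atTop.1 hev
    refine ⟨K, fun n hn => ?_⟩
    have h1 : ‖ℓ (r K) - ℓ (r n)‖ ^ 2 ≤ 2 * (‖ℓ (r n)‖ ^ 2 - ‖ℓ (r K)‖ ^ 2) :=
      (hℓ _ (hr_ge K)).norm_sub_sq_le (hℓ _ (hr_ge n))
        (hℓ _ (show ε₀ ≤ (r K + r n) / 2 by linarith [hr_ge K, hr_ge n])) (hr_anti hn)
    have h2 : ‖ℓ (r n)‖ ^ 2 ≤ S ^ 2 := pow_le_pow_left₀ (norm_nonneg _) (hle_S n) 2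
    have h3 : ‖ℓ (r n) - ℓ (r K)‖ ^ 2 < η ^ 2 := by
      rw [norm_sub_rev]; linarith [hK K le_rfl]
    rw [dist_eq_norm]
    exact lt_of_pow_lt_pow_left₀ 2 hη.le h3
  obtain ⟨m, hm⟩ := cauchySeq_tendsto_of_complete hcauchy
  -- its limit is feasible at radius `ε₀` …
  have hm_feas : m ∈ feasible V x₀ ε₀ := by
    rw [mem_feasible]
    have hc : Tendsto (fun n => ‖x₀ - V (ℓ (r n))‖) atTop (𝓝 ‖x₀ - V m‖) := by
      have hcont : Continuous fun a : E => ‖x₀ - V a‖ := by fun_prop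
      exact (hcont.tendsto m).comp hm
    exact le_of_tendsto_of_tendsto' hc hr_tend fun n => (hℓ _ (hr_ge n)).norm_sub_le
  -- … and has norm `S`, so `S = N(ε₀)` by minimality of `ℓ ε₀`
  have hm_norm : ‖m‖ = S := tendsto_nhds_unique ((continuous_norm.tendsto m).comp hm) hNS
  have hS_eq : S = ‖ℓ ε₀‖ := le_antisymm hS_le (by rw [← hm_norm]; exact h0.norm_le hm_feas)
  -- ε–δ at `ε₀` from the right
  refine Metric.continuousWithinAt_iff.2 fun η hη => ?_
  have hev : ∀ᶠ n in atTop, ‖ℓ ε₀‖ ^ 2 - η ^ 2 / 2 < ‖ℓ (r n)‖ ^ 2 := by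
    rw [hS_eq] at hNS2
    exact hNS2.eventually (lt_mem_nhds (by nlinarith))
  obtain ⟨K, hK⟩ := Filter.eventually_atTop.1 hev
  refine ⟨1 / ((K : ℝ) + 1), by positivity, fun {ε} hε hdist => ?_⟩
  have hε' : ε₀ ≤ ε := hε
  have hεK : ε ≤ r K := by
    rw [Real.dist_eq, abs_of_nonneg (by linarith)] at hdist
    simp only [hr]; linarith
  have h2 : ‖ℓ (r K)‖ ^ 2 ≤ ‖ℓ ε‖ ^ 2 := pow_le_pow_left₀ (norm_nonneg _) (hanti hε' hεK) 2
  have h4 : ‖ℓ ε - ℓ ε₀‖ ^ 2 < η ^ 2 := by linarith [hK K le_rfl, hpar hε']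
  rw [dist_eq_norm]
  exact lt_of_pow_lt_pow_left₀ 2 hη.le h4

/-- **(18) on a closed ray of radii.**  If `ℓ_ε` is the minimal vector of (1) at every radius `ε ≥ ε₀` (coefficient
space complete), then `ε ↦ ℓ_ε` is continuous on `[ε₀, ∞)`: two-sided at `ε > ε₀` by the open-set theorem
`continuousOn_minimiser` on `(ε₀, ∞)`, one-sided at `ε₀` by `continuousWithinAt_Ici_minimiser`. [cite: Enflo2023, v2 p.6, eq. (18)] -/
theorem continuousOn_Ici_minimiser [CompleteSpace E] (hℓ : ∀ ε ∈ Set.Ici ε₀, IsMinimal V x₀ ε (ℓ ε)) :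
    ContinuousOn ℓ (Set.Ici ε₀) := by
  intro ε hε
  rcases eq_or_lt_of_le (show ε₀ ≤ ε from hε) with h | h
  · subst h
    exact continuousWithinAt_Ici_minimiser hℓ
  · have hO : ContinuousOn ℓ (Set.Ioi ε₀) :=
      continuousOn_minimiser isOpen_Ioi fun e he => hℓ e (le_of_lt (show ε₀ < e from he))
    exact (hO.continuousAt (Ioi_mem_nhds h)).continuousWithinAt

/-- **(18) on the whole domain of `ε ↦ ℓ_ε`.**  If `ℓ_ε` is the minimal vector of (1) at every feasible radius
(coefficient space complete), then `ε ↦ ℓ_ε` is continuous on the feasibility domain `feasibleRadii V x₀` — whether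
that up-set is an open ray or a closed one. [cite: Enflo2023, v2 p.6, eq. (18)] -/
theorem continuousOn_minimiser_feasibleRadii [CompleteSpace E]
    (hℓ : ∀ ε ∈ feasibleRadii V x₀, IsMinimal V x₀ ε (ℓ ε)) :
    ContinuousOn ℓ (feasibleRadii V x₀) := by
  intro ε hε
  rcases feasibleRadii_eq_Ici_or V x₀ hε with hD | ⟨ε₁, hε₁, hlt⟩
  · have hI : ContinuousOn ℓ (Set.Ici ε) :=
      continuousOn_Ici_minimiser fun e he => hℓ e (Ici_subset_feasibleRadii V x₀ hε he)
    rw [hD]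
    exact hI ε Set.self_mem_Ici
  · have hO : ContinuousOn ℓ (Set.Ioi ε₁) :=
      continuousOn_minimiser isOpen_Ioi fun e he =>
        hℓ e (Ici_subset_feasibleRadii V x₀ hε₁ (le_of_lt (show ε₁ < e from he)))
    exact (hO.continuousAt (Ioi_mem_nhds hlt)).continuousWithinAt

/-- Hence the minimal norm `N(ε) = ‖ℓ_ε‖` — convex and non-increasing (`Eq18.lean`) — is continuous on the whole
feasibility domain, the possible attained endpoint included (where convexity alone would allow a jump). [cite: Enflo2023, v2 p.6, eq. (18)] -/
theorem continuousOn_norm_minimiser_feasibleRadii [CompleteSpace E]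
    (hℓ : ∀ ε ∈ feasibleRadii V x₀, IsMinimal V x₀ ε (ℓ ε)) :
    ContinuousOn (fun ε => ‖ℓ ε‖) (feasibleRadii V x₀) :=
  continuous_norm.comp_continuousOn (continuousOn_minimiser_feasibleRadii hℓ)

/-- **(18) with existence and uniqueness, on the whole domain.**  For a complete coefficient space, THE minimal-vector
map `ε ↦ ℓ_ε` is defined exactly on `feasibleRadii V x₀` (`exists_isMinimal`, `IsMinimal.unique`,
`mem_feasibleRadii_iff_exists_isMinimal`) and is continuous there. [cite: Enflo2023, v2 p.6, eq. (18)] -/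
theorem exists_continuousOn_minimiser_feasibleRadii [CompleteSpace E] (V : E →L[ℂ] H) (x₀ : H) :
    ∃ ℓ : ℝ → E, (∀ ε ∈ feasibleRadii V x₀, IsMinimal V x₀ ε (ℓ ε)) ∧
      (∀ ε ∈ feasibleRadii V x₀, ∀ a, IsMinimal V x₀ ε a → a = ℓ ε) ∧
      ContinuousOn ℓ (feasibleRadii V x₀) := by
  classical
  let ℓ : ℝ → E := fun ε =>
    if h : ε ∈ feasibleRadii V x₀ then Classical.choose (exists_isMinimal V x₀ ε h) else 0
  have hsel : ∀ ε ∈ feasibleRadii V x₀, IsMinimal V x₀ ε (ℓ ε) := fun ε hε => by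
    simp only [ℓ, dif_pos hε]
    exact Classical.choose_spec (exists_isMinimal V x₀ ε hε)
  exact ⟨ℓ, hsel, fun ε hε a ha => ha.unique (hsel ε hε), continuousOn_minimiser_feasibleRadii hsel⟩

end coefficient

section operator

variable {H : Type*} [NormedAddCommGroup H] [InnerProductSpace ℂ H] [CompleteSpace H]

namespace Vy

/-- For `V = V_y` every radius `ε ≥ ‖x₀ − y‖` is feasible (`a = e₀`: `V_y e₀ = y`), so the closed ray
`[‖x₀ − y‖, ∞)` lies in the domain of `ε ↦ ℓ_ε`. [cite: Enflo2023, v2 p.2, eq. (1)–(2)] -/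
lemma Ici_subset_feasibleRadii_V (T : H →L[ℂ] H) (hT : ‖T‖ < 1) (y x₀ : H) :
    Set.Ici ‖x₀ - y‖ ⊆ feasibleRadii (V T hT y) x₀ := by
  refine Ici_subset_feasibleRadii (V T hT y) x₀ ⟨lp.single 2 0 (1 : ℂ), ?_⟩
  rw [mem_feasible, V_single, pow_zero, one_apply_eq_self]

/-- **(18) on the closed ray, hypothesis-free on the paper's objects.**  For ANY bounded `T` with `‖T‖ < 1` and any
`x₀, y`: the minimal vectors `ℓ_ε` of (1) for `V_y` exist and are unique at every radius `ε ≥ ‖x₀ − y‖`, and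
`ε ↦ ℓ_ε` (in `ℓ²`) and `ε ↦ ℓ_ε(T)` (in `B(H)`, operator norm) are continuous on the CLOSED ray `[‖x₀ − y‖, ∞)`,
endpoint included (`Eq18.lean`'s `eq18_Ioi` had the open ray). [cite: Enflo2023, v2 p.6, eq. (18)] -/
theorem eq18_Ici (T : H →L[ℂ] H) (hT : ‖T‖ < 1) (y x₀ : H) :
    ∃ ℓ : ℝ → ℓ2, (∀ ε ∈ Set.Ici ‖x₀ - y‖, IsMinimal (V T hT y) x₀ ε (ℓ ε)) ∧
      (∀ ε ∈ Set.Ici ‖x₀ - y‖, ∀ a, IsMinimal (V T hT y) x₀ ε a → a = ℓ ε) ∧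
      ContinuousOn ℓ (Set.Ici ‖x₀ - y‖) ∧
      ContinuousOn (fun ε => Vop T hT (ℓ ε)) (Set.Ici ‖x₀ - y‖) := by
  obtain ⟨ℓ, hsel, huniq, hcont⟩ := exists_continuousOn_minimiser_feasibleRadii (V T hT y) x₀
  have hsub := Ici_subset_feasibleRadii_V T hT y x₀
  refine ⟨ℓ, fun ε hε => hsel ε (hsub hε), fun ε hε => huniq ε (hsub hε), hcont.mono hsub, ?_⟩
  exact (continuous_Vop T hT).comp_continuousOn (hcont.mono hsub)

/-- **(18) on the whole domain of `ε ↦ ℓ_ε`, on the paper's objects.**  For any `T` with `‖T‖ < 1` and any `x₀, y`: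
THE minimal-vector map `ε ↦ ℓ_ε` of (1) for `V_y` is defined exactly on the feasibility domain
`feasibleRadii (V_y) x₀` (all radii `ε` with `‖x₀ − ℓ(T)y‖ ≤ ε` solvable; it contains `[‖x₀ − y‖, ∞)`), and there
both `ε ↦ ℓ_ε` (in `ℓ²`) and `ε ↦ ℓ_ε(T)` (operator norm) are continuous — the maximal literal reading of (18). [cite: Enflo2023, v2 p.6, eq. (18)] -/
theorem eq18_feasibleRadii (T : H →L[ℂ] H) (hT : ‖T‖ < 1) (y x₀ : H) :
    ∃ ℓ : ℝ → ℓ2, (∀ ε ∈ feasibleRadii (V T hT y) x₀, IsMinimal (V T hT y) x₀ ε (ℓ ε)) ∧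
      (∀ ε ∈ feasibleRadii (V T hT y) x₀, ∀ a, IsMinimal (V T hT y) x₀ ε a → a = ℓ ε) ∧
      ContinuousOn ℓ (feasibleRadii (V T hT y) x₀) ∧
      ContinuousOn (fun ε => Vop T hT (ℓ ε)) (feasibleRadii (V T hT y) x₀) := by
  obtain ⟨ℓ, hsel, huniq, hcont⟩ := exists_continuousOn_minimiser_feasibleRadii (V T hT y) x₀
  exact ⟨ℓ, hsel, huniq, hcont, (continuous_Vop T hT).comp_continuousOn hcont⟩

end Vy

end operator

end Literature.Analysis.OperatorTheory.Enflo2023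

end
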